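import Summits.BirchSwinnertonDyer.BirchSwinnertonDyer.Theorems.EisensteinDepletionAtTwoStarGlueLemmas
import HarnessLib

/-!
# Route `EisensteinDepletionAtTwo`, crux E1M `DepletedLambdaLawAtTwoMod` (item stmt-BirchSwinnertonDyer-20341),
# line `star` — the Λ-GLUE of the first split of (★): a mod-2 CUSP CONGRUENCE plus the transform of the
# C-normalised Eisenstein measure determine `red(pfree L₂(f))` (curve side; stub `stub_starGlue` of `Lines/star.lean` v2)

Cell `bsd-rank2` (HOME run/shared/lean/pub/bsd-rank2/), seat `bsd-rank2-star-p1` (lead of line `star`). THEOREMS ONLY — no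
definition, no named fact, no `sorry`. HONEST FRAMING: `Λ`-bookkeeping and elementary 2-adic estimates; the two research /
analytic halves of (★) — the cusp congruence (★-SymbC) and the Eisenstein transform (★-EisNorm) — enter as HYPOTHESES
(`hC`, `hH`) about an ARBITRARY function `v : ℕ → ℤ → ℚ`; nothing here reads an analytic rank and BSD is not proved by any
of this (PARTITION D-0054: none — r_an ≥ 2 axis S0, door T-r3₂).

**Setting.** `W/ℚ` globally minimal, good ordinary at `2`, `f` a newform of `W`, `α = unitRoot W 2`, `μ_f = msdMeasure f α`
(the Mazur–Swinnerton-Dyer measure, `μ_f(a + 2ᵐℤ₂) = α⁻ᵐ[a/2ᵐ]⁺ − α⁻ᵐ⁻¹[a/2ᵐ⁻¹]⁺`), `L₂(f, α) = padicLFunction f α` its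
transform; `Λ = ℤ₂⟦T⟧`, `ι : Λ → ℚ₂⟦T⟧`, `red : Λ → 𝔽₂⟦T⟧`, `pfree` the `2`-free part (`X1.MuLambda`).

* Part 1 (`…StarGlueLemmas.lean`) §1 — three `Λ`-lemmas: coefficientwise congruence mod `𝔪` ⇒ equal reductions (`red_eq_red_of_norm_coeff_sub_lt_one`);
  the PRIMITIVE-SCALE TRANSFER `exists_units_pfree_eq_C_mul`: two rational multiples `L₀ ≠ 0`, `L₁` in `Λ` of one power
  series with `red L₁ ≠ 0` satisfy `pfree L₀ = u·L₁`, `u ∈ ℤ_p^×`; at `p = 2` literally `red(pfree L₀) = red L₁`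
  (`red_pfree_eq_red_two`, since `𝔽₂^× = {1}`).
* §2 — at `p = 2` the Riemann sums split into the two `η`-halves `a ≡ ±5ˢ` (`distributionRiemannSum_two_eq_add`), and
  `5ˢ ≡ 1`, `−5ˢ ≡ 3 (mod 4)`.
* §3 — helpers: `Σ_{s<N} C(s,k) = C(N,k+1)`, `‖C(2ⁿ,k+1)‖₂ ≤ 2⁻ⁿ/‖k+1‖₂`, units of `ℤ₂` are `≡ 1 (mod 2)`, in particular
  the inverse powers of the unit root.
* §4 — **the pointwise congruence** `norm_msdMeasure_sub_cuspNorm_le_half`: if on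
  `C = {(m,a) : m ≥ 3, a ≡ 1 (4), 1 < a < 2ᵐ}` the integers `([a/2ᵐ]⁺ − [1/2ᵐ]⁺)/g` and `v(m,a)/g'` are congruent mod `2`
  (`v(m,1) = 0`), then on every `η = +1` class of level `n+2 ≥ 4`,
  `‖g⁻¹(μ_f(a) − μ_f(1)) − (v(n+2,a) − v(n+1, a mod 2ⁿ⁺¹))/g'‖₂ ≤ 1/2` (`α ≡ 1 (mod 2)`, periodicity `[r+1]⁺ = [r]⁺`).
* §5 — **the glue** `red_pfree_eq_of_cuspCongruence`: if moreover the Riemann sums of the C-normalised measure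
  `ν₀(a + 2ⁿℤ₂) = (v(n,a) − v(n−1, a mod 2ⁿ⁻¹))/g'` (`n ≥ 4`, `a ≡ 1 (4)`; `0` otherwise) converge coefficientwise to `ι H`,
  `red H ≠ 0`, then `red(pfree L₀) = red H` for every nonzero `L₀ ∈ Λ` with `ι L₀ = c·L₂(f, α)`. Mechanism:
  `g⁻¹·RS(μ_f) − 2·RS(ν₀) = 2·Σ_s D_s C(s,k) + 2δ·C(2ⁿ,k+1)`, `‖D_s‖ ≤ 1/2` (§4), `δ = g⁻¹μ_f(1+2ⁿ⁺²ℤ₂)` bounded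
  (`exists_norm_msdMeasure_le_of_isNewformOf`), `‖C(2ⁿ,k+1)‖₂ → 0`, the `Δ`-doubling `padicLRiemannSum_two`; hence
  `‖g⁻¹[Tᵏ]L₂ − 2[Tᵏ]ιH‖ ≤ 1/4`, `(2g)⁻¹L₂ = ι L₁` with `red L₁ = red H`, and §1.
In the lead's skeleton `Cruxes/DepletedLambdaLawAtTwoMod/Lines/star.lean` v2 this closes `stub_starGlue :
StarSymbC → StarEisNorm → StarCoreAtTwo` with `v = stabEisCuspDiff N_W β` (numerics of the normalisation: kit j283910).

References: B. Mazur, J. Tate, J. Teitelbaum, Invent. Math. 84 (1986), §I.10–I.13 [MazurTateTeitelbaum1986Invent];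
L. Washington, GTM 83, §7.1 [Washington1997]; R. Greenberg, V. Vatsal, Invent. Math. 142 (2000), §3 [GreenbergVatsal2000].
-/

set_option linter.dupNamespace false
set_option autoImplicit false

noncomputable section

open scoped Classical
open scoped MatrixGroups

open Filter Topology CongruenceSubgroup
  Literature.NumberTheory.EllipticCurves Literature.NumberTheory.EllipticCurves.ModularForms
  Summit.BirchSwinnertonDyer.Rank1Residual.X1.MuLambda

namespace Summit.BirchSwinnertonDyer.BirchSwinnertonDyer.Theorems.DepletionAtTwo

/-! ## §4. The pointwise congruence on the `η = +1` classes -/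

section Pointwise

/-- Ultrametric: `‖x + y‖ ≤ r` if both `‖x‖, ‖y‖ ≤ r`. [folklore] -/
theorem norm_add_le_of_le_two {x y : ℚ_[2]} {r : ℝ} (hx : ‖x‖ ≤ r) (hy : ‖y‖ ≤ r) : ‖x + y‖ ≤ r :=
  (Padic.nonarchimedean x y).trans (max_le hx hy)

/-- Ultrametric: `‖x − y‖ ≤ r` if both `‖x‖, ‖y‖ ≤ r`. [folklore] -/
theorem norm_sub_le_of_le_two {x y : ℚ_[2]} {r : ℝ} (hx : ‖x‖ ≤ r) (hy : ‖y‖ ≤ r) : ‖x - y‖ ≤ r := by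
  rw [sub_eq_add_neg]; exact norm_add_le_of_le_two hx (by rwa [norm_neg])

variable {N : ℕ} [NeZero N] (f : CuspForm (Gamma0 N) 2)

omit [NeZero N] in
/-- The Mazur–Swinnerton-Dyer measure at level `n + 2`, unfolded: `μ(a + 2ⁿ⁺²ℤ₂) = α⁻ⁿ⁻²[a/2ⁿ⁺²]⁺ − α⁻ⁿ⁻³[a/2ⁿ⁺¹]⁺`.
[cite: MazurTateTeitelbaum1986Invent, §I.10 (10.1)] -/
theorem msdMeasure_level_add_two (α : ℚ_[2]) (n : ℕ) (a : ZMod (2 ^ (n + 2))) :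
    msdMeasure f α (n + 2) a =
      α⁻¹ ^ (n + 2) * (ratPlusSymbol f ((a.val : ℚ) / (2 : ℚ) ^ (n + 2)) : ℚ_[2]) -
        α⁻¹ ^ (n + 3) * (ratPlusSymbol f ((a.val : ℚ) / (2 : ℚ) ^ (n + 1)) : ℚ_[2]) := by
  simp only [msdMeasure]
  norm_num

/-- Periodicity of the plus symbol on the half-level cusp: `[A/2ᵐ]⁺ = [(A mod 2ᵐ)/2ᵐ]⁺` (`[r + 1]⁺ = [r]⁺`,
`ratPlusSymbol_add_intCast_eq`). [cite: MazurTateTeitelbaum1986Invent, §I.4 (4.2)] -/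
theorem ratPlusSymbol_div_two_pow_eq_mod (m A : ℕ) :
    ratPlusSymbol f ((A : ℚ) / (2 : ℚ) ^ m) = ratPlusSymbol f (((A % 2 ^ m : ℕ) : ℚ) / (2 : ℚ) ^ m) := by
  have h := Nat.mod_add_div A (2 ^ m)
  have h2 : ((2 : ℚ) ^ m) ≠ 0 := pow_ne_zero _ two_ne_zero
  have hq : (A : ℚ) = ((A % 2 ^ m : ℕ) : ℚ) + (2 : ℚ) ^ m * ((A / 2 ^ m : ℕ) : ℚ) := by
    exact_mod_cast h.symm
  have hA : (A : ℚ) / (2 : ℚ) ^ m = ((A % 2 ^ m : ℕ) : ℚ) / (2 : ℚ) ^ m + (((A / 2 ^ m : ℕ) : ℤ) : ℚ) := by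
    rw [hq, add_div, mul_div_cancel_left₀ _ h2, Int.cast_natCast]
  rw [hA, ratPlusSymbol_add_intCast_eq]

omit [NeZero N] in
/-- The `C`-congruence (given on `1 < b`) extended to `b = 1` (both sides `0`) and rewritten with `(2:ℚ)^m`. -/
theorem cuspCongruence_of_C (v : ℕ → ℤ → ℚ) (hv1 : ∀ m : ℕ, v m 1 = 0) (g g' : ℚ)
    (hC : ∀ (m : ℕ) (a : ℤ), 3 ≤ m → a % 4 = 1 → 1 < a → a < 2 ^ m →
      ∃ n n' : ℤ, ratPlusSymbol f ((a : ℚ) / (2 ^ m : ℕ)) - ratPlusSymbol f (1 / (2 ^ m : ℕ)) = n * g ∧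
        v m a = n' * g' ∧ (n : ZMod 2) = (n' : ZMod 2))
    (m b : ℕ) (hm : 3 ≤ m) (hb4 : b % 4 = 1) (hb : b < 2 ^ m) :
    ∃ n n' : ℤ, ratPlusSymbol f ((b : ℚ) / (2 : ℚ) ^ m) = n * g + ratPlusSymbol f (1 / (2 : ℚ) ^ m) ∧
      v m b = n' * g' ∧ (n : ZMod 2) = (n' : ZMod 2) := by
  by_cases h1 : b = 1
  · subst h1
    refine ⟨0, 0, ?_, ?_, rfl⟩
    · push_cast; ring
    · rw [Nat.cast_one, hv1, Int.cast_zero, zero_mul]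
  · have h1' : 1 < (b : ℤ) := by omega
    have hb4' : (b : ℤ) % 4 = 1 := by omega
    have hb' : (b : ℤ) < 2 ^ m := by exact_mod_cast hb
    obtain ⟨n, n', h, hv, hn⟩ := hC m b hm hb4' h1' hb'
    refine ⟨n, n', ?_, hv, hn⟩
    push_cast at h
    linear_combination h

variable {W : WeierstrassCurve ℚ} [W.IsElliptic] [W.IsGloballyMinimal]

omit [W.IsElliptic] in
/-- **The pointwise congruence (G1).** On the `η = +1` unit class `a ≡ 1 (mod 4)` of level `n + 2` (`n ≥ 2`), the
`a = 1`-normalised Mazur–Swinnerton-Dyer measure of `f` in units of the primitive scale `g` and the `C`-normalised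
Eisenstein-side difference in units of `g'` agree modulo `2ℤ₂`:
`‖g⁻¹(μ_f(a) − μ_f(1)) − (v(n+2, a) − v(n+1, a mod 2ⁿ⁺¹))/g'‖₂ ≤ 1/2`
(the unit root `α ≡ 1 (mod 2)`, the integers of the two sides are congruent mod `2` on `C`, and the level constants cancel).
[cite: MazurTateTeitelbaum1986Invent, §I.10–I.13] -/
theorem norm_msdMeasure_sub_cuspNorm_le_half (hord : IsOrdinaryAt W 2)
    (v : ℕ → ℤ → ℚ) (hv1 : ∀ m : ℕ, v m 1 = 0) (g g' : ℚ) (hg : g ≠ 0) (hg' : g' ≠ 0)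
    (hC : ∀ (m : ℕ) (a : ℤ), 3 ≤ m → a % 4 = 1 → 1 < a → a < 2 ^ m →
      ∃ n n' : ℤ, ratPlusSymbol f ((a : ℚ) / (2 ^ m : ℕ)) - ratPlusSymbol f (1 / (2 ^ m : ℕ)) = n * g ∧
        v m a = n' * g' ∧ (n : ZMod 2) = (n' : ZMod 2))
    {n : ℕ} (hn : 2 ≤ n) (a : ZMod (2 ^ (n + 2))) (ha : a.val % 4 = 1) :
    ‖((g : ℚ_[2]))⁻¹ * (msdMeasure f (unitRoot W 2 : ℚ_[2]) (n + 2) a -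
        msdMeasure f (unitRoot W 2 : ℚ_[2]) (n + 2) 1) -
      (((v (n + 2) (a.val : ℤ) - v (n + 1) ((a.val % 2 ^ (n + 1) : ℕ) : ℤ)) / g' : ℚ) : ℚ_[2])‖ ≤ 2⁻¹ := by
  set α : ℚ_[2] := (unitRoot W 2 : ℚ_[2]) with hα
  set A : ℕ := a.val with hA
  set abar : ℕ := A % 2 ^ (n + 1) with habar
  have hAlt : A < 2 ^ (n + 2) := ZMod.val_lt a
  have h4 : 4 ∣ 2 ^ (n + 1) := by
    have := pow_dvd_pow 2 (show 2 ≤ n + 1 by omega); simpa using this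
  have habar4 : abar % 4 = 1 := by
    rw [habar, Nat.mod_mod_of_dvd _ h4]
    exact ha
  have habarlt : abar < 2 ^ (n + 1) := Nat.mod_lt _ (pow_pos two_pos _)
  obtain ⟨n₁, n₁', hS1, hv1', hc1⟩ := cuspCongruence_of_C f v hv1 g g' hC (n + 2) A (by omega) ha hAlt
  obtain ⟨n₂, n₂', hS2, hv2', hc2⟩ := cuspCongruence_of_C f v hv1 g g' hC (n + 1) abar (by omega) habar4 habarlt
  have hone : (1 : ZMod (2 ^ (n + 2))).val = 1 := by
    rw [ZMod.val_one_eq_one_mod, Nat.mod_eq_of_lt (Nat.one_lt_two_pow (by omega))]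
  have hμa := msdMeasure_level_add_two f α n a
  have hμ1 := msdMeasure_level_add_two f α n 1
  rw [← hA, ratPlusSymbol_div_two_pow_eq_mod f (n + 1) A, ← habar, hS1, hS2] at hμa
  rw [hone, Nat.cast_one] at hμ1
  have hν : (( ((v (n + 2) (A : ℤ) - v (n + 1) (abar : ℤ)) / g' : ℚ) : ℚ_[2])) =
      (n₁' : ℚ_[2]) - (n₂' : ℚ_[2]) := by
    rw [hv1', hv2', ← sub_mul, mul_div_cancel_right₀ _ hg']
    push_cast
    ring
  rw [hμa, hμ1, hν]
  have hgq : (g : ℚ_[2]) ≠ 0 := by exact_mod_cast hg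
  have hid : (g : ℚ_[2])⁻¹ * (α⁻¹ ^ (n + 2) * (((n₁ : ℚ) * g + ratPlusSymbol f (1 / (2 : ℚ) ^ (n + 2)) : ℚ) : ℚ_[2]) -
        α⁻¹ ^ (n + 3) * (((n₂ : ℚ) * g + ratPlusSymbol f (1 / (2 : ℚ) ^ (n + 1)) : ℚ) : ℚ_[2]) -
        (α⁻¹ ^ (n + 2) * ((ratPlusSymbol f ((1 : ℚ) / (2 : ℚ) ^ (n + 2)) : ℚ) : ℚ_[2]) -
          α⁻¹ ^ (n + 3) * ((ratPlusSymbol f ((1 : ℚ) / (2 : ℚ) ^ (n + 1)) : ℚ) : ℚ_[2]))) -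
      ((n₁' : ℚ_[2]) - (n₂' : ℚ_[2])) =
      ((α⁻¹ ^ (n + 2) - 1) * (n₁ : ℚ_[2]) + ((n₁ : ℚ_[2]) - n₁')) -
        ((α⁻¹ ^ (n + 3) - 1) * (n₂ : ℚ_[2]) + ((n₂ : ℚ_[2]) - n₂')) := by
    push_cast
    field_simp
    ring
  rw [hid]
  refine norm_sub_le_of_le_two (norm_add_le_of_le_two ?_ (norm_intCast_sub_le_half_of_zmod_eq hc1))
    (norm_add_le_of_le_two ?_ (norm_intCast_sub_le_half_of_zmod_eq hc2))
  · rw [norm_mul]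
    calc ‖α⁻¹ ^ (n + 2) - 1‖ * ‖(n₁ : ℚ_[2])‖ ≤ 2⁻¹ * 1 := by
          gcongr
          · exact norm_unitRoot_inv_pow_sub_one_le_half hord _
          · exact Padic.norm_int_le_one n₁
      _ = 2⁻¹ := mul_one _
  · rw [norm_mul]
    calc ‖α⁻¹ ^ (n + 3) - 1‖ * ‖(n₂ : ℚ_[2])‖ ≤ 2⁻¹ * 1 := by
          gcongr
          · exact norm_unitRoot_inv_pow_sub_one_le_half hord _
          · exact Padic.norm_int_le_one n₂
      _ = 2⁻¹ := mul_one _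

end Pointwise

/-! ## §5. The glue: `red(pfree L₀) = red H` -/

section Glue

variable {N : ℕ} [NeZero N] (f : CuspForm (Gamma0 N) 2) {W : WeierstrassCurve ℚ} [W.IsElliptic] [W.IsGloballyMinimal]

/-- **(★-glue), curve side.** Let `W/ℚ` be good ordinary at `2` with newform `f` and unit root `α`, let
`v : ℕ → ℤ → ℚ` be any function with `v(m, 1) = 0` (the Eisenstein cusp differences), `g, g' ≠ 0` scales such that on
`C = {(m,a) : m ≥ 3, a ≡ 1 (4), 1 < a < 2ᵐ}` the integers `([a/2ᵐ]⁺_f − [1/2ᵐ]⁺_f)/g` and `v(m,a)/g'` are congruent mod `2`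
(this is (★-SymbC)), and suppose the Riemann sums of the `C`-normalised measure
`ν₀(a + 2ⁿℤ₂) = (v(n,a) − v(n−1, a mod 2ⁿ⁻¹))/g'` (`n ≥ 4`, `a ≡ 1 (4)`; `0` otherwise) converge coefficientwise to `ι H`,
`H ∈ Λ` with `red H ≠ 0` (this is (★-EisNorm)). Then for every nonzero `L₀ ∈ Λ` with `ι L₀ = c·L₂(f, α)`:
`red(pfree L₀) = red H`. PROOF: `g⁻¹·RS(μ_f) − 2·RS(ν₀) = 2·Σ_s D_s·C(s,k) + 2δ·C(2ⁿ, k+1)` with `‖D_s‖ ≤ 1/2` (§4) and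
`δ = g⁻¹μ_f(1 + 2ⁿ⁺²ℤ₂)` bounded, `‖C(2ⁿ, k+1)‖₂ → 0`; hence `‖g⁻¹[T^k]L₂ − 2[T^k]ιH‖ ≤ 1/4`, so `(2g)⁻¹L₂ = ιL₁` with
`red L₁ = red H`, and the primitive-scale transfer gives `red(pfree L₀) = red L₁`.
[cite: MazurTateTeitelbaum1986Invent, §I.10–I.13] [cite: Washington1997, §7.1] -/
theorem red_pfree_eq_of_cuspCongruence (hord : IsOrdinaryAt W 2) (hf : IsNewformOf W f)
    (v : ℕ → ℤ → ℚ) (hv1 : ∀ m : ℕ, v m 1 = 0) (g g' : ℚ) (hg : g ≠ 0) (hg' : g' ≠ 0)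
    (hC : ∀ (m : ℕ) (a : ℤ), 3 ≤ m → a % 4 = 1 → 1 < a → a < 2 ^ m →
      ∃ n n' : ℤ, ratPlusSymbol f ((a : ℚ) / (2 ^ m : ℕ)) - ratPlusSymbol f (1 / (2 ^ m : ℕ)) = n * g ∧
        v m a = n' * g' ∧ (n : ZMod 2) = (n' : ZMod 2))
    (H : IwasawaAlgebra 2)
    (hH : ∀ k : ℕ, Tendsto (distributionRiemannSum (fun n a ↦
        if 4 ≤ n ∧ a.val % 4 = 1 then
          (((v n (a.val : ℤ) - v (n - 1) ((a.val % 2 ^ (n - 1) : ℕ) : ℤ)) / g' : ℚ) : ℚ_[2])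
        else 0) k) atTop (𝓝 (PowerSeries.coeff k (iwasawaToPowerSeries 2 H))))
    (hredH : red H ≠ 0)
    {c : ℚ} {L₀ : IwasawaAlgebra 2} (hL₀ : L₀ ≠ 0)
    (hι : iwasawaToPowerSeries 2 L₀ = PowerSeries.C (c : ℚ_[2]) * padicLFunction f (unitRoot W 2 : ℚ_[2])) :
    red (pfree L₀) = red H := by
  set α : ℚ_[2] := (unitRoot W 2 : ℚ_[2]) with hα
  set ν : (n : ℕ) → ZMod (2 ^ n) → ℚ_[2] := fun n a ↦
    if 4 ≤ n ∧ a.val % 4 = 1 then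
      (((v n (a.val : ℤ) - v (n - 1) ((a.val % 2 ^ (n - 1) : ℕ) : ℤ)) / g' : ℚ) : ℚ_[2])
    else 0 with hν
  obtain ⟨C₀, hC₀⟩ := exists_norm_msdMeasure_le_of_isNewformOf hord hf
  have hC₀' : 0 ≤ C₀ := (norm_nonneg _).trans (hC₀ 0 0)
  have hRSf : ∀ k, Tendsto (padicLRiemannSum f α k) atTop (𝓝 (padicLCoeff f α k)) :=
    tendsto_padicLRiemannSum_of_isNewformOf hord hf
  have hgq : (g : ℚ_[2]) ≠ 0 := by exact_mod_cast hg
  -- Step 1: `‖g⁻¹·[T^k]L₂(f) − 2·[T^k]ιH‖ ≤ 1/4`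
  have hkey : ∀ k : ℕ, ‖(g : ℚ_[2])⁻¹ * padicLCoeff f α k -
      2 * PowerSeries.coeff k (iwasawaToPowerSeries 2 H)‖ ≤ 4⁻¹ := by
    intro k
    set E : ℕ → ℚ_[2] := fun n ↦ (g : ℚ_[2])⁻¹ * padicLRiemannSum f α k n -
      2 * distributionRiemannSum ν k n with hE
    set B : ℕ → ℚ_[2] := fun n ↦ 2 * ((g : ℚ_[2])⁻¹ * msdMeasure f α (n + 2) 1) *
      (((2 ^ n).choose (k + 1) : ℕ) : ℚ_[2]) with hB
    have hEt : Tendsto E atTop (𝓝 ((g : ℚ_[2])⁻¹ * padicLCoeff f α k -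
        2 * PowerSeries.coeff k (iwasawaToPowerSeries 2 H))) :=
      ((hRSf k).const_mul _).sub ((hH k).const_mul _)
    have hBt : Tendsto B atTop (𝓝 0) := by
      refine squeeze_zero_norm (a := fun n ↦ (‖(2 : ℚ_[2])‖ * (‖(g : ℚ_[2])⁻¹‖ * C₀) *
        ‖(k : ℚ_[2]) + 1‖⁻¹) * (2⁻¹ : ℝ) ^ n) (fun n ↦ ?_) ?_
      · calc ‖B n‖ = ‖(2 : ℚ_[2])‖ * (‖(g : ℚ_[2])⁻¹‖ * ‖msdMeasure f α (n + 2) 1‖) *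
              ‖(((2 ^ n).choose (k + 1) : ℕ) : ℚ_[2])‖ := by
              simp only [hB, norm_mul]
          _ ≤ ‖(2 : ℚ_[2])‖ * (‖(g : ℚ_[2])⁻¹‖ * C₀) * ((2 : ℝ)⁻¹ ^ n * ‖(k : ℚ_[2]) + 1‖⁻¹) := by
              gcongr
              · exact hC₀ _ _
              · exact norm_choose_two_pow_succ_le n k
          _ = _ := by ring
      · have h := (tendsto_pow_atTop_nhds_zero_of_lt_one (show (0 : ℝ) ≤ 2⁻¹ by norm_num)
          (show (2⁻¹ : ℝ) < 1 by norm_num)).const_mul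
          (‖(2 : ℚ_[2])‖ * (‖(g : ℚ_[2])⁻¹‖ * C₀) * ‖(k : ℚ_[2]) + 1‖⁻¹)
        rwa [mul_zero] at h
    have hAt : Tendsto (fun n ↦ E n - B n) atTop (𝓝 ((g : ℚ_[2])⁻¹ * padicLCoeff f α k -
        2 * PowerSeries.coeff k (iwasawaToPowerSeries 2 H))) := by
      have h := hEt.sub hBt
      rwa [sub_zero] at h
    refine le_of_tendsto hAt.norm (eventually_atTop.mpr ⟨2, fun n hn ↦ ?_⟩)
    have hνneg : ∀ s : ZMod (2 ^ n),
        ν (n + 2) (-((cyclotomicGenerator 2 : ZMod (2 ^ (n + 2))) ^ s.val)) = 0 := by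
      intro s
      have h3 := val_neg_cyclotomicGenerator_pow_mod_four n s.val
      simp only [hν]
      rw [if_neg]
      rintro ⟨-, h1⟩
      omega
    have hνpos : ∀ s : ZMod (2 ^ n),
        ν (n + 2) ((cyclotomicGenerator 2 : ZMod (2 ^ (n + 2))) ^ s.val) =
          ((((v (n + 2) ((((cyclotomicGenerator 2 : ZMod (2 ^ (n + 2))) ^ s.val).val : ℕ) : ℤ) -
            v (n + 1) ((((cyclotomicGenerator 2 : ZMod (2 ^ (n + 2))) ^ s.val).val % 2 ^ (n + 1) : ℕ) : ℤ))
              / g' : ℚ) : ℚ_[2])) := by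
      intro s
      have h1 := val_cyclotomicGenerator_pow_mod_four n s.val
      simp only [hν]
      rw [if_pos ⟨by omega, h1⟩, show n + 2 - 1 = n + 1 by omega]
    have hsumC : ∑ s : ZMod (2 ^ n), ((s.val.choose k : ℕ) : ℚ_[2]) =
        (((2 ^ n).choose (k + 1) : ℕ) : ℚ_[2]) := by
      rw [sum_zmod_val_eq_sum_range (2 ^ n) (fun i ↦ ((i.choose k : ℕ) : ℚ_[2])),
        ← sum_range_choose_eq_choose_succ, Nat.cast_sum]
    have hzero : ∑ s : ZMod (2 ^ n), ν (n + 2) (-((cyclotomicGenerator 2 : ZMod (2 ^ (n + 2))) ^ s.val)) *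
        (s.val.choose k : ℚ_[2]) = 0 :=
      Finset.sum_eq_zero fun s _ ↦ by rw [hνneg s, zero_mul]
    have hexp : E n - B n = 2 * ∑ s : ZMod (2 ^ n),
        ((g : ℚ_[2])⁻¹ * (msdMeasure f α (n + 2) ((cyclotomicGenerator 2 : ZMod (2 ^ (n + 2))) ^ s.val) -
            msdMeasure f α (n + 2) 1) -
          ν (n + 2) ((cyclotomicGenerator 2 : ZMod (2 ^ (n + 2))) ^ s.val)) * (s.val.choose k : ℚ_[2]) := by
      simp only [hE, hB]
      rw [padicLRiemannSum_two f α k n, distributionRiemannSum_two_eq_add ν k n, hzero, add_zero, ← hsumC]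
      simp only [Finset.mul_sum, ← Finset.sum_sub_distrib]
      exact Finset.sum_congr rfl fun s _ ↦ by ring
    rw [hexp, norm_mul, TwoAdicTwistConverse.norm_two_padic_two]
    have hsum : ‖∑ s : ZMod (2 ^ n),
        ((g : ℚ_[2])⁻¹ * (msdMeasure f α (n + 2) ((cyclotomicGenerator 2 : ZMod (2 ^ (n + 2))) ^ s.val) -
            msdMeasure f α (n + 2) 1) -
          ν (n + 2) ((cyclotomicGenerator 2 : ZMod (2 ^ (n + 2))) ^ s.val)) * (s.val.choose k : ℚ_[2])‖ ≤ 2⁻¹ := by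
      refine IsUltrametricDist.norm_sum_le_of_forall_le_of_nonneg (by norm_num) fun s _ ↦ ?_
      rw [norm_mul, hνpos s]
      calc _ ≤ (2⁻¹ : ℝ) * 1 := by
            gcongr
            · exact norm_msdMeasure_sub_cuspNorm_le_half f hord v hv1 g g' hg hg' hC hn _
                (val_cyclotomicGenerator_pow_mod_four n s.val)
            · exact norm_cast_choose_le_one _ _
        _ = 2⁻¹ := mul_one _
    calc (2 : ℝ)⁻¹ * _ ≤ 2⁻¹ * 2⁻¹ := by gcongr
      _ = 4⁻¹ := by norm_num
  -- Step 2: `Y = (2g)⁻¹·L₂(f)` is within `1/2` of `ιH`, hence integral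
  set Y : PowerSeries ℚ_[2] := PowerSeries.C ((2 : ℚ_[2])⁻¹ * (g : ℚ_[2])⁻¹) * padicLFunction f α with hY
  have hYk : ∀ k, PowerSeries.coeff k Y - PowerSeries.coeff k (iwasawaToPowerSeries 2 H) =
      (2 : ℚ_[2])⁻¹ * ((g : ℚ_[2])⁻¹ * padicLCoeff f α k - 2 * PowerSeries.coeff k (iwasawaToPowerSeries 2 H)) := by
    intro k
    have h2 : (2 : ℚ_[2]) ≠ 0 := two_ne_zero
    rw [hY, PowerSeries.coeff_C_mul, coeff_padicLFunction, mul_sub, ← mul_assoc, ← mul_assoc,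
      inv_mul_cancel₀ h2, one_mul]
  have hYH : ∀ k, ‖PowerSeries.coeff k Y - PowerSeries.coeff k (iwasawaToPowerSeries 2 H)‖ ≤ 2⁻¹ := by
    intro k
    rw [hYk, norm_mul, norm_inv, TwoAdicTwistConverse.norm_two_padic_two, inv_inv]
    calc (2 : ℝ) * _ ≤ 2 * 4⁻¹ := by gcongr; exact hkey k
      _ = 2⁻¹ := by norm_num
  have hY1 : ∀ k, ‖PowerSeries.coeff k Y‖ ≤ 1 := by
    intro k
    have h1 : ‖PowerSeries.coeff k (iwasawaToPowerSeries 2 H)‖ ≤ 1 := by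
      rw [PowerSeries.coeff_map]; exact PadicInt.norm_le_one _
    have : PowerSeries.coeff k Y = (PowerSeries.coeff k Y - PowerSeries.coeff k (iwasawaToPowerSeries 2 H)) +
        PowerSeries.coeff k (iwasawaToPowerSeries 2 H) := by ring
    rw [this]
    exact norm_add_le_of_le_two ((hYH k).trans (by norm_num)) h1
  obtain ⟨L₁, hL₁⟩ := (exists_iwasawaToPowerSeries_eq_iff_norm_coeff_le_one Y).mpr hY1
  -- Step 3: `red L₁ = red H`
  have hred1 : red L₁ = red H := by
    refine red_eq_red_of_norm_coeff_sub_lt_one fun k ↦ ?_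
    have h := hYH k
    rw [← hL₁, PowerSeries.coeff_map, PowerSeries.coeff_map] at h
    change ‖((PowerSeries.coeff k L₁ : ℤ_[2]) : ℚ_[2]) - ((PowerSeries.coeff k H : ℤ_[2]) : ℚ_[2])‖ ≤ 2⁻¹ at h
    rw [← PadicInt.coe_sub, PadicInt.padic_norm_e_of_padicInt] at h
    exact h.trans_lt (by norm_num)
  -- Step 4: primitive-scale transfer
  have hredL₁ : red L₁ ≠ 0 := by rw [hred1]; exact hredH
  rw [red_pfree_eq_red_two hL₀ hι hL₁ hredL₁, hred1]

end Glue

end Summit.BirchSwinnertonDyer.BirchSwinnertonDyer.Theorems.DepletionAtTwo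

end
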